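import Summits.CriticalPhenomena.PercolationContinuityZ3.Theorems.PercNearOneGluingNoHeavyLowerTailCovTauStarNPrelim
import Summits.CriticalPhenomena.PercolationContinuityZ3.Theorems.PercNearOneGluingAdditiveGluingBystanderCluster
import Literature.Probability.Percolation.TwoSetConditionalAssociation
import HarnessLib

/-!
# Lemma (★_N) of the conditioned covariance transfer COV(τ)

THE CHAIN.  COV(τ):
`Cov(Ψ(C_x), 1{o∈C_x} | x↮y) ≥ μ(o↔v | v↮x, v↮y)·Cov(Ψ(C_x), 1{v∈C_x} | x↮y)`; it yields (S5)₂
(`SurplusTransfer.surplusTransfer_pair_of_covTransfer`), (GEN) for three relays (`gen_triple_of_covTransfer`) and hence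
Kozma–Nitzan's Conjecture 1 for `|A| = 3`.  Its proof has three Lean pieces: Lemma (★_N) (THIS FILE; indicator form modulo BHK in `…CovTauStarN.lean`), the two-source
induction A2 and the final combination (via `BHK2006_twoMarkerCov_le_of_within_of_forall_nondegenerate`).

LEMMA (★_N).  Bond percolation with weights `p ∈ [0,1]` on a finite set `D` of pairs; vertices `x, v`,
a source set `N`, `Ψ` monotone nonnegative on edge sets, `C_x` the open EDGE cluster of `x`.  With
`B(W) = Cov_{G∖W}(Ψ(C_x), 1{x↔v})` (the world `G ∖ W` = the pairs meeting `W` closed, `off W`) and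
`Y(N) = E[ B(V(C_N)) ; x ∉ C_N ]`:
      `Y(N) · P(x ↮ v) ≤ P(x ↮ v, v ↮ N) · B(∅)`        (`starN_ED`, finitary form `ED`/`wtW` of `DecisionTreeWeighted`).

PROOF.  Let `ℱ_N` be the exploration σ-algebra of `C_N` — the decision tree
`SetClusterExploration.ttree` (Literature), which reveals exactly the pairs of `D` meeting `C_N`; conditional
expectations `cE` along it and the decision-tree Harris inequality for REAL monotone functions are in
`…NoHeavyLowerTailTreeHarrisReal.lean` (`TreeHarris.treeHarris_real`, [Gladkov2024, Thm. 3.2]).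
1. MARKOV (`splice_congr_of_not_mem_reached` / `splice_congr_of_mem_reached`): from `x ∉ C_N(K)` the hybrid `K →_{S_N(K)} K₂`
   looks like `off (C_N K) K₂`; from `x ∈ C_N(K)` it looks like `K`.  Hence (law of total covariance, tower `ED_cE`, symmetry
   `ED_mul_cE_comm`):  `B(∅) = Y(N) + Cov(ĝ, 1{x↔v})`, `ĝ = E[Ψ(C_x) | ℱ_N]`.
2. TREE-HARRIS: `Cov(ĝ, 1{x↔v} + Z) ≥ 0` with `Z = 1{x↮v}·1{v↔N}` (`{x↔v} ∪ {v↔N}` is increasing), and `Z` is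
   `ℱ_N`-measurable (`hZloc`), so `Cov(ĝ, Z) = E[(Ψ − t) Z]`.
3. BHK 1.4 (`bhk14_ED`, from `BHK2006_twoSetConditionalAssociation.negCorrelation` through the finitary bridges
   `integral_eq_ED` / `ED_univ_eq_ED_of_zero`): given `x ↮ v`, `Ψ(C_x)` and `1{v↔N}` are negatively correlated.
4. Linear combination.
Also: `covOff`, `yN`, `fcl`, `hr`, `nr`, `off` (the objects, as `ED`-expressions), cluster congruence lemmas
(`reachable_congr_of_agree`, `openEdgeCluster_congr_of_agree`).  The forms in the vocabulary of the two-source induction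
(`CovTauStarN.yf_mul_mf_le` / `yf_le_bf`) are in `…CovTauStarBridge.lean`, and the corollary "`Y` is antitone" is
`CovTau.Yf_antitone_of_le_Bf` (`…CovTauA2Anti.lean`).
[cite: Gladkov2024, Thm. 3.2 (p. 4)] [cite: VandenbergHaggstromKahn2005, Thm. 1.4 (p. 7), eq. (6) (p. 4)]
-/

noncomputable section

namespace Summit.CriticalPhenomena.PercolationContinuityZ3.Theorems

namespace CovTauStarN

open Finset MeasureTheory Literature.Probability.Percolation Literature.Probability.Percolation.DecisionTree
open Literature.Probability.LatticeModels (prodBernoulli)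
open SetClusterExploration TreeHarris
open scoped Classical

/-! ### Small `ED`/`cE` calculus on `D.powerset` -/

section EDCalc

variable {ι : Type*} [DecidableEq ι] (D : Finset ι) (p : ι → ℝ)

/-- Expectations of functions agreeing on the configurations `⊆ D` agree. [folklore] -/
theorem ED_congr_on {φ ψ : Finset ι → ℝ} (h : ∀ K ∈ D.powerset, φ K = ψ K) : ED D p φ = ED D p ψ :=
  Finset.sum_congr rfl fun K hK => by rw [h K hK]

/-- Differences. [folklore] -/
theorem ED_sub (φ ψ : Finset ι → ℝ) : ED D p (fun K => φ K - ψ K) = ED D p φ - ED D p ψ := by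
  unfold ED; rw [← Finset.sum_sub_distrib]; exact Finset.sum_congr rfl fun _ _ => by ring

variable (Fm : Finset ι → Finset ι)

/-- Pull-out of a factor constant along the splices of configurations `⊆ D`. [folklore] -/
theorem cE_mul_of_local_on {Z : Finset ι → ℝ} {K : Finset ι}
    (hZ : ∀ K₂ ∈ D.powerset, Z (splice (Fm K) K K₂) = Z K) (φ : Finset ι → ℝ) :
    cE D p Fm (fun L => Z L * φ L) K = Z K * cE D p Fm φ K := by
  unfold cE
  rw [Finset.mul_sum]
  refine Finset.sum_congr rfl fun K₂ hK₂ => ?_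
  show wtW D p K₂ * (Z (splice (Fm K) K K₂) * φ (splice (Fm K) K K₂)) = _
  rw [hZ K₂ hK₂]; ring

/-- `cE` of a conditional expectation is itself (self-determined `Fm`). [cite: Gladkov2024, Def. 2.4] -/
theorem cE_cE (hF : SelfDetermined Fm) (φ : Finset ι → ℝ) (K : Finset ι) :
    cE D p Fm (cE D p Fm φ) K = cE D p Fm φ K := by
  have h := cE_mul_of_local D p Fm (Z := cE D p Fm φ) (cE_local D p hF φ) (fun _ => (1 : ℝ)) K
  simp only [mul_one] at h
  rw [h, cE_const, mul_one]

end EDCalc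

/-! ### BHK's Theorem 1.4 (two clusters) in finitary form on the coordinates `D` -/

section BHK14

variable {V : Type*} [Fintype V] [DecidableEq V]

/-- `{v ↔ N}` read on the edge cluster of `v`: `v ∈ N` or some edge of `C_v` contains a vertex of `N`. [folklore] -/
theorem nr_eq_ite (N : Finset V) (v : V) (K : Finset (Sym2 V)) :
    nr N v K = if (v ∈ N ∨ ∃ e ∈ openEdgeCluster (↑K : Set (Sym2 V)) v, ∃ s ∈ N, s ∈ e) then 1 else 0 := by
  unfold nr ind
  have key : (∃ s ∈ N, (openGraph (↑K : Set (Sym2 V))).Reachable s v) ↔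
      (v ∈ N ∨ ∃ e ∈ openEdgeCluster (↑K : Set (Sym2 V)) v, ∃ s ∈ N, s ∈ e) := by
    constructor
    · rintro ⟨s, hs, hsv⟩
      by_cases hsv' : s = v
      · exact Or.inl (hsv' ▸ hs)
      · right
        obtain ⟨q⟩ := hsv
        cases q with
        | nil => exact absurd rfl hsv'
        | @cons _ u _ hadj q' =>
            have hadj2 := hadj
            rw [openGraph_adj] at hadj2
            refine ⟨s(s, u), ?_, s, hs, Sym2.mem_mk_left s u⟩
            rw [mem_openEdgeCluster_iff]
            refine ⟨hadj2.1, by rw [Sym2.mk_isDiag_iff]; exact hadj2.2, fun t ht => ?_⟩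
            have hvs : (openGraph (↑K : Set (Sym2 V))).Reachable v s := (hadj.reachable.trans ⟨q'⟩).symm
            rcases Sym2.mem_iff.1 ht with rfl | rfl
            · exact hvs
            · exact ⟨q'.reverse⟩
    · rintro (hv | ⟨e, he, s, hs, hse⟩)
      · exact ⟨v, hv, SimpleGraph.Reachable.refl _⟩
      · rw [mem_openEdgeCluster_iff] at he
        exact ⟨s, hs, (he.2.2 s hse).symm⟩
  by_cases h : ∃ s ∈ N, (openGraph (↑K : Set (Sym2 V))).Reachable s v
  · rw [if_pos (show K ∈ {L : Finset (Sym2 V) | ∃ s ∈ N, (openGraph (↑L : Set (Sym2 V))).Reachable s v} from h),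
      if_pos (key.1 h)]
  · rw [if_neg (show K ∉ {L : Finset (Sym2 V) | ∃ s ∈ N, (openGraph (↑L : Set (Sym2 V))).Reachable s v} from h),
      if_neg (fun h' => h (key.2 h'))]

/-- **BHK Theorem 1.4 (set form), finitary, on the coordinates `D`**: given `x ↮ v`, `Ψ(C_x)` (↑ in `C_x`) and
`1{v ↔ N}` (↑ in `C_v`) are negatively correlated:
`P(x↮v)·E[Ψ(C_x) 1{v↔N}; x↮v] ≤ E[1{v↔N}; x↮v]·E[Ψ(C_x); x↮v]`.
[cite: VandenbergHaggstromKahn2005, Thm. 1.4 (p. 7) with Remark 1 after Thm. 1.2 (p. 5)] -/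
theorem bhk14_ED (D : Finset (Sym2 V)) {p : Sym2 V → ℝ} (hp0 : ∀ e, 0 ≤ p e) (hp1 : ∀ e, p e ≤ 1)
    (N : Finset V) (x v : V) (Ψ : Set (Sym2 V) → ℝ) (hΨ : Monotone Ψ) :
    ED D p (fun K => 1 - hr x v K) * ED D p (fun K => fcl Ψ x K * ((1 - hr x v K) * nr N v K)) ≤
      ED D p (fun K => (1 - hr x v K) * nr N v K) * ED D p (fun K => fcl Ψ x K * (1 - hr x v K)) := by
  -- the weights on all pairs: `p` on `D`, `0` elsewhere
  set w : Sym2 V → unitInterval := fun e => if e ∈ D then ⟨max 0 (min 1 (p e)), by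
    exact ⟨le_max_left _ _, max_le zero_le_one (min_le_left _ _)⟩⟩ else 0 with hw
  have hwD : ∀ e ∈ D, ((w e : unitInterval) : ℝ) = p e := fun e he => by
    simp only [hw, if_pos he]
    rw [min_eq_right (hp1 e), max_eq_right (hp0 e)]
  have hwD' : ∀ e ∉ D, ((w e : unitInterval) : ℝ) = 0 := fun e he => by simp only [hw, if_neg he]; rfl
  have hED : ∀ φ : Finset (Sym2 V) → ℝ, ED Finset.univ (fun e => (w e : ℝ)) φ = ED D p φ :=
    fun φ => ED_univ_eq_ED_of_zero D p _ hwD hwD' φ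
  -- the increasing test function of `C_v`
  set G : Set (Sym2 V) → ℝ := fun C => if (v ∈ N ∨ ∃ e ∈ C, ∃ s ∈ N, s ∈ e) then 1 else 0 with hG
  have hGmono : Monotone G := by
    intro C C' hCC'
    simp only [hG]
    by_cases h : v ∈ N ∨ ∃ e ∈ C, ∃ s ∈ N, s ∈ e
    · rw [if_pos h, if_pos (h.imp id (fun ⟨e, he, hs⟩ => ⟨e, hCC' he, hs⟩))]
    · rw [if_neg h]; split_ifs <;> norm_num
  have key := BHK2006_twoSetConditionalAssociation.negCorrelation w {x} {v} Ψ G hΨ hGmono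
  -- the conditioning event
  set D0 : Set (Set (Sym2 V)) := {ω | ∀ s ∈ ({x} : Set V), ∀ t ∈ ({v} : Set V), ¬ (openGraph ω).Reachable s t}
    with hD0
  have hind : ∀ K : Finset (Sym2 V), ind D0 (↑K : Set (Sym2 V)) = 1 - hr x v K := by
    intro K
    unfold hr
    by_cases h : (openGraph (↑K : Set (Sym2 V))).Reachable x v
    · rw [ind_of_mem (show K ∈ {L : Finset (Sym2 V) | (openGraph (↑L : Set (Sym2 V))).Reachable x v} from h),
        ind_of_not_mem (show (↑K : Set (Sym2 V)) ∉ D0 from fun hK => hK x rfl v rfl h)]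
      ring
    · rw [ind_of_not_mem (show K ∉ {L : Finset (Sym2 V) | (openGraph (↑L : Set (Sym2 V))).Reachable x v} from h),
        ind_of_mem (show (↑K : Set (Sym2 V)) ∈ D0 from fun s hs t ht => by
          rw [Set.mem_singleton_iff] at hs ht; rw [hs, ht]; exact h)]
      ring
  simp only [Set.biUnion_singleton] at key
  rw [measureReal_eq_ED, setIntegral_eq_ED, setIntegral_eq_ED, setIntegral_eq_ED, hED, hED, hED, hED] at key
  have e1 : ED D p (fun K => ind D0 (↑K : Set (Sym2 V))) = ED D p (fun K => 1 - hr x v K) :=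
    ED_congr_on D p fun K _ => hind K
  have e2 : ED D p (fun K => ind D0 (↑K : Set (Sym2 V)) *
      (Ψ (openEdgeCluster (↑K : Set (Sym2 V)) x) * G (openEdgeCluster (↑K : Set (Sym2 V)) v))) =
      ED D p (fun K => fcl Ψ x K * ((1 - hr x v K) * nr N v K)) :=
    ED_congr_on D p fun K _ => by rw [hind, nr_eq_ite, fcl]; ring
  have e3 : ED D p (fun K => ind D0 (↑K : Set (Sym2 V)) * Ψ (openEdgeCluster (↑K : Set (Sym2 V)) x)) =
      ED D p (fun K => fcl Ψ x K * (1 - hr x v K)) :=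
    ED_congr_on D p fun K _ => by rw [hind, fcl]; ring
  have e4 : ED D p (fun K => ind D0 (↑K : Set (Sym2 V)) * G (openEdgeCluster (↑K : Set (Sym2 V)) v)) =
      ED D p (fun K => (1 - hr x v K) * nr N v K) :=
    ED_congr_on D p fun K _ => by rw [hind, nr_eq_ite]
  rw [e1, e2, e3, e4] at key
  linarith

end BHK14

/-! ### Lemma (★_N) -/

section Main

variable {V : Type*} [Fintype V] [DecidableEq V]

/-- **Lemma (★_N) of the conditioned covariance transfer, finitary form**.  On the
coordinates `D` with weights `p ∈ [0,1]^D`, for vertices `x, v`, a source set `N` and `Ψ` monotone nonnegative on edge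
sets, with `B(W) = Cov_{G∖W}(Ψ(C_x), 1{x↔v})` (`covOff`) and `Y(N) = E[B(V(C_N)); x ∉ C_N]` (`yN`):
`Y(N) · P(x ↮ v) ≤ P(x ↮ v, v ↮ N) · B(∅)`.
Proof: law of total covariance along the exploration σ-algebra `ℱ_N` of `C_N` (tree `SetClusterExploration.ttree`,
revealing exactly the pairs meeting `C_N`; outside it the hybrid is the world `G ∖ C_N`), the decision-tree Harris
inequality `Cov(E[Ψ(C_x) | ℱ_N], 1{v ↔ N ∪ {x}}) ≥ 0` (`TreeHarris.treeHarris_real`, [Gladkov2024, Thm. 3.2]), and BHK's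
Theorem 1.4 for `Ψ(C_x)` and `1{v ↔ N}` given `x ↮ v` (`bhk14_ED`).
[cite: Gladkov2024, Thm. 3.2 (p. 4)] [cite: VandenbergHaggstromKahn2005, Thm. 1.4 (p. 7), eq. (6) (p. 4)] -/
theorem starN_ED (D : Finset (Sym2 V)) {p : Sym2 V → ℝ} (hp0 : ∀ e, 0 ≤ p e) (hp1 : ∀ e, p e ≤ 1)
    (N : Finset V) (x v : V) (Ψ : Set (Sym2 V) → ℝ) (hΨ : Monotone Ψ) (hΨ0 : ∀ C, 0 ≤ Ψ C) :
    yN D p Ψ x v N * ED D p (fun K => 1 - hr x v K) ≤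
      ED D p (fun K => (1 - hr x v K) * (1 - nr N v K)) * covOff D p Ψ x v ∅ := by
  have hSD : SelfDetermined (revealedAt D N) := selfDetermined_revealedAt
  have hrev : revealed (ttree D (D.card + 1) (init N)) = revealedAt D N :=
    funext fun K => (revealedAt_eq_revealed (D := D) N K).symm
  /- 1. MARKOV: the conditional expectations given the exploration data of `C_N`. -/
  have hA : ∀ K ∈ D.powerset, x ∉ reached D N K →
      cE D p (revealedAt D N) (fun L => fcl Ψ x L * hr x v L) K =
          ED D p (fun K₂ => fcl Ψ x (off (reached D N K) K₂) * hr x v (off (reached D N K) K₂)) ∧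
        cE D p (revealedAt D N) (fcl Ψ x) K = ED D p (fun K₂ => fcl Ψ x (off (reached D N K) K₂)) ∧
        cE D p (revealedAt D N) (hr x v) K = ED D p (fun K₂ => hr x v (off (reached D N K) K₂)) := by
    intro K hK hx
    rw [Finset.mem_powerset] at hK
    have hpt : ∀ K₂ ∈ D.powerset,
        fcl Ψ x (splice (revealedAt D N K) K K₂) = fcl Ψ x (off (reached D N K) K₂) ∧
          hr x v (splice (revealedAt D N K) K K₂) = hr x v (off (reached D N K) K₂) := by
      intro K₂ hK₂
      rw [Finset.mem_powerset] at hK₂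
      obtain ⟨hreach, hclu⟩ := splice_congr_of_not_mem_reached hK hK₂ hx
      exact ⟨by simp only [fcl, hclu], BystanderBHK.ind_congr (hreach v).symm⟩
    refine ⟨?_, ?_, ?_⟩
    · exact Finset.sum_congr rfl fun K₂ hK₂ => by
        show wtW D p K₂ * (fcl Ψ x _ * hr x v _) = _
        rw [(hpt K₂ hK₂).1, (hpt K₂ hK₂).2]
    · exact Finset.sum_congr rfl fun K₂ hK₂ => by rw [(hpt K₂ hK₂).1]
    · exact Finset.sum_congr rfl fun K₂ hK₂ => by rw [(hpt K₂ hK₂).2]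
  have hA' : ∀ K ∈ D.powerset, x ∈ reached D N K →
      cE D p (revealedAt D N) (fun L => fcl Ψ x L * hr x v L) K = fcl Ψ x K * hr x v K ∧
        cE D p (revealedAt D N) (fcl Ψ x) K = fcl Ψ x K ∧ cE D p (revealedAt D N) (hr x v) K = hr x v K := by
    intro K hK hx
    rw [Finset.mem_powerset] at hK
    have hpt : ∀ K₂ ∈ D.powerset,
        fcl Ψ x (splice (revealedAt D N K) K K₂) = fcl Ψ x K ∧ hr x v (splice (revealedAt D N K) K K₂) = hr x v K := by
      intro K₂ hK₂
      rw [Finset.mem_powerset] at hK₂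
      obtain ⟨hreach, hclu⟩ := splice_congr_of_mem_reached hK hK₂ hx
      exact ⟨by simp only [fcl, hclu], BystanderBHK.ind_congr (hreach v).symm⟩
    refine ⟨?_, ?_, ?_⟩
    · calc cE D p (revealedAt D N) (fun L => fcl Ψ x L * hr x v L) K
          = ∑ K₂ ∈ D.powerset, wtW D p K₂ * (fcl Ψ x K * hr x v K) :=
            Finset.sum_congr rfl fun K₂ hK₂ => by
              show wtW D p K₂ * (fcl Ψ x _ * hr x v _) = _
              rw [(hpt K₂ hK₂).1, (hpt K₂ hK₂).2]
        _ = fcl Ψ x K * hr x v K := by rw [← Finset.sum_mul, sum_wtW, one_mul]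
    · calc cE D p (revealedAt D N) (fcl Ψ x) K = ∑ K₂ ∈ D.powerset, wtW D p K₂ * fcl Ψ x K :=
            Finset.sum_congr rfl fun K₂ hK₂ => by rw [(hpt K₂ hK₂).1]
        _ = fcl Ψ x K := by rw [← Finset.sum_mul, sum_wtW, one_mul]
    · calc cE D p (revealedAt D N) (hr x v) K = ∑ K₂ ∈ D.powerset, wtW D p K₂ * hr x v K :=
            Finset.sum_congr rfl fun K₂ hK₂ => by rw [(hpt K₂ hK₂).2]
        _ = hr x v K := by rw [← Finset.sum_mul, sum_wtW, one_mul]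
  /- 2. LAW OF TOTAL COVARIANCE: `Y(N) = E[Ψ·1_v] − E[ĝ·ȟ]` and `E[ĝ ȟ] = E[ĝ 1_v]`. -/
  have hY : yN D p Ψ x v N = ED D p (fun K => fcl Ψ x K * hr x v K) -
      ED D p (fun K => cE D p (revealedAt D N) (fcl Ψ x) K * cE D p (revealedAt D N) (hr x v) K) := by
    rw [← ED_cE D p hSD (fun K => fcl Ψ x K * hr x v K), ← ED_sub]
    refine ED_congr_on D p fun K hK => ?_
    by_cases hx : x ∈ reached D N K
    · obtain ⟨h1, h2, h3⟩ := hA' K hK hx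
      rw [h1, h2, h3, ind_of_not_mem (show K ∉ {L : Finset (Sym2 V) | x ∉ reached D N L} from fun h' => h' hx)]
      ring
    · obtain ⟨h1, h2, h3⟩ := hA K hK hx
      rw [h1, h2, h3, ind_of_mem (show K ∈ {L : Finset (Sym2 V) | x ∉ reached D N L} from hx), one_mul]
      rfl
  have hC : ED D p (fun K => cE D p (revealedAt D N) (fcl Ψ x) K * cE D p (revealedAt D N) (hr x v) K) =
      ED D p (fun K => cE D p (revealedAt D N) (fcl Ψ x) K * hr x v K) := by
    rw [ED_mul_cE_comm D p hSD (cE D p (revealedAt D N) (fcl Ψ x)) (hr x v)]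
    exact ED_congr_on D p fun K _ => by rw [cE_cE D p (revealedAt D N) hSD (fcl Ψ x) K]
  have hB0 : covOff D p Ψ x v ∅ = ED D p (fun K => fcl Ψ x K * hr x v K) - ED D p (fcl Ψ x) * ED D p (hr x v) := by
    simp only [covOff, off_empty]
  /- 3. DECISION-TREE HARRIS for `E[Ψ(C_x) | ℱ_N]` and the increasing event `{x↔v} ∪ {v↔N}`. -/
  have hGup : IsUpperSet {L : Finset (Sym2 V) | (openGraph (↑L : Set (Sym2 V))).Reachable x v ∨
      ∃ s ∈ N, (openGraph (↑L : Set (Sym2 V))).Reachable s v} := by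
    intro L L' hLL' hL
    have hmono : openGraph (↑L : Set (Sym2 V)) ≤ openGraph (↑L' : Set (Sym2 V)) :=
      openGraph_mono (Finset.coe_subset.2 hLL')
    exact hL.imp (fun h => h.mono hmono) (fun ⟨s, hs, h⟩ => ⟨s, hs, h.mono hmono⟩)
  have hTH0 := treeHarris_real D hp0 hp1 (ttree D (D.card + 1) (init N)) (fcl_mono Ψ x hΨ) (fun K => hΨ0 _) hGup
  rw [hrev, PrW_eq_sum_ind] at hTH0
  have hTH : ED D p (fcl Ψ x) * (ED D p (hr x v) + ED D p (fun K => (1 - hr x v K) * nr N v K)) ≤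
      ED D p (fun K => cE D p (revealedAt D N) (fcl Ψ x) K * hr x v K) +
        ED D p (fun K => cE D p (revealedAt D N) (fcl Ψ x) K * ((1 - hr x v K) * nr N v K)) := by
    have eG : ∑ S ∈ D.powerset, wtW D p S *
        ind {L : Finset (Sym2 V) | (openGraph (↑L : Set (Sym2 V))).Reachable x v ∨
          ∃ s ∈ N, (openGraph (↑L : Set (Sym2 V))).Reachable s v} S =
        ED D p (hr x v) + ED D p (fun K => (1 - hr x v K) * nr N v K) := by
      rw [← ED_add]
      exact Finset.sum_congr rfl fun K _ => by rw [ind_union_eq]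
    have eR : ED D p (fun K => cE D p (revealedAt D N) (fcl Ψ x) K *
        ind {L : Finset (Sym2 V) | (openGraph (↑L : Set (Sym2 V))).Reachable x v ∨
          ∃ s ∈ N, (openGraph (↑L : Set (Sym2 V))).Reachable s v} K) =
        ED D p (fun K => cE D p (revealedAt D N) (fcl Ψ x) K * hr x v K) +
          ED D p (fun K => cE D p (revealedAt D N) (fcl Ψ x) K * ((1 - hr x v K) * nr N v K)) := by
      rw [← ED_add]
      exact ED_congr_on D p fun K _ => by
        show _ = cE D p (revealedAt D N) (fcl Ψ x) K * hr x v K +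
          cE D p (revealedAt D N) (fcl Ψ x) K * ((1 - hr x v K) * nr N v K)
        rw [ind_union_eq]; ring
    rw [← eG, ← eR]
    exact hTH0
  /- 4. The `ℱ_N`-measurable factor `Z = 1{x↮v}·1{v↔N}` comes out: `E[ĝ Z] = E[Ψ(C_x) Z]`. -/
  have hZloc : ∀ K ∈ D.powerset, ∀ K₂ ∈ D.powerset,
      (1 - hr x v (splice (revealedAt D N K) K K₂)) * nr N v (splice (revealedAt D N K) K K₂) =
        (1 - hr x v K) * nr N v K := by
    intro K hK K₂ hK₂
    rw [Finset.mem_powerset] at hK hK₂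
    have hsub : splice (revealedAt D N K) K K₂ ⊆ D := splice_subset hK hK₂
    -- `1{v ↔ N}` is decided by the exploration
    have hn : nr N v (splice (revealedAt D N K) K K₂) = nr N v K := by
      refine BystanderBHK.ind_congr ?_
      show (∃ s ∈ N, _) ↔ (∃ s ∈ N, _)
      rw [← mem_reached_iff' hsub, ← mem_reached_iff' hK, reached_splice]
    rw [hn]
    by_cases hvN : v ∈ reached D N K
    · -- `v ∈ C_N`: `1{x ↔ v}` is decided as well
      by_cases hx : x ∈ reached D N K
      · rw [show hr x v (splice (revealedAt D N K) K K₂) = hr x v K from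
          BystanderBHK.ind_congr ((splice_congr_of_mem_reached hK hK₂ hx).1 v).symm]
      · have h0 : ∀ L : Finset (Sym2 V), L ⊆ D → x ∉ reached D N L → v ∈ reached D N L → hr x v L = 0 := by
          intro L hL hxL hvL
          refine ind_of_not_mem fun hxv => hxL ?_
          obtain ⟨s, hs, hsv⟩ := (mem_reached_iff' hL).1 hvL
          exact (mem_reached_iff' hL).2 ⟨s, hs, hsv.trans (SimpleGraph.Reachable.symm hxv)⟩
        rw [h0 K hK hx hvN, h0 _ hsub (by rwa [reached_splice]) (by rwa [reached_splice])]
    · rw [show nr N v K = 0 from ind_of_not_mem fun h => hvN ((mem_reached_iff' hK).2 h), mul_zero, mul_zero]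
  have hEZ : ED D p (fun K => cE D p (revealedAt D N) (fcl Ψ x) K * ((1 - hr x v K) * nr N v K)) =
      ED D p (fun K => fcl Ψ x K * ((1 - hr x v K) * nr N v K)) := by
    calc ED D p (fun K => cE D p (revealedAt D N) (fcl Ψ x) K * ((1 - hr x v K) * nr N v K))
        = ED D p (cE D p (revealedAt D N) (fun L => ((1 - hr x v L) * nr N v L) * fcl Ψ x L)) :=
          ED_congr_on D p fun K hK => by
            rw [cE_mul_of_local_on D p (revealedAt D N) (fun K₂ hK₂ => hZloc K hK K₂ hK₂) (fcl Ψ x)]; ring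
      _ = ED D p (fun L => ((1 - hr x v L) * nr N v L) * fcl Ψ x L) := ED_cE D p hSD _
      _ = ED D p (fun K => fcl Ψ x K * ((1 - hr x v K) * nr N v K)) := ED_congr_on D p fun K _ => by
          show (1 - hr x v K) * nr N v K * fcl Ψ x K = fcl Ψ x K * ((1 - hr x v K) * nr N v K); ring
  /- 5. BHK 1.4 and the constants. -/
  have hG := bhk14_ED D hp0 hp1 N x v Ψ hΨ
  have hEf : ED D p (cE D p (revealedAt D N) (fcl Ψ x)) = ED D p (fcl Ψ x) := ED_cE D p hSD _
  have hP : ED D p (fun K => 1 - hr x v K) = 1 - ED D p (hr x v) := by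
    have h := ED_sub D p (fun _ => (1 : ℝ)) (hr x v)
    have h1 : ED D p (fun _ => (1 : ℝ)) = 1 := by unfold ED; rw [← Finset.sum_mul, sum_wtW, one_mul]
    rw [h1] at h
    exact h
  have hQ : ED D p (fun K => (1 - hr x v K) * (1 - nr N v K)) =
      ED D p (fun K => 1 - hr x v K) - ED D p (fun K => (1 - hr x v K) * nr N v K) := by
    rw [← ED_sub]
    exact ED_congr_on D p fun K _ => by
      show (1 - hr x v K) * (1 - nr N v K) = (1 - hr x v K) - (1 - hr x v K) * nr N v K; ring
  have hFh : ED D p (fun K => fcl Ψ x K * (1 - hr x v K)) = ED D p (fcl Ψ x) - ED D p (fun K => fcl Ψ x K * hr x v K) := by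
    rw [← ED_sub]
    exact ED_congr_on D p fun K _ => by
      show fcl Ψ x K * (1 - hr x v K) = fcl Ψ x K - fcl Ψ x K * hr x v K; ring
  have hP0 : 0 ≤ ED D p (fun K => 1 - hr x v K) :=
    Finset.sum_nonneg fun K _ => mul_nonneg (wtW_nonneg D hp0 hp1 K) (by linarith [(hr_nonneg_le_one x v K).2])
  /- 6. Combination. -/
  -- names for the expectations
  set Efh := ED D p (fun K => fcl Ψ x K * hr x v K) with hEfh
  set Ef := ED D p (fcl Ψ x) with hEf'
  set Eh := ED D p (hr x v) with hEh'
  set Cgh := ED D p (fun K => cE D p (revealedAt D N) (fcl Ψ x) K * hr x v K) with hCgh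
  set EZ := ED D p (fun K => (1 - hr x v K) * nr N v K) with hEZ'
  set EfZ := ED D p (fun K => fcl Ψ x K * ((1 - hr x v K) * nr N v K)) with hEfZ
  rw [hEZ] at hTH
  rw [hP, hFh] at hG
  rw [hY, hC, hQ, hP, hB0]
  -- `P0·(Cgh − Ef·Eh) ≥ P0·(Ef·EZ − EfZ)` (TH times `P0 ≥ 0`) and BHK 1.4
  have h1 : (1 - Eh) * (Ef * EZ - EfZ) ≤ (1 - Eh) * (Cgh - Ef * Eh) := by
    rw [hP] at hP0
    exact mul_le_mul_of_nonneg_left (by linarith) hP0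
  have key : (1 - Eh - EZ) * (Efh - Ef * Eh) - (Efh - Cgh) * (1 - Eh) =
      ((1 - Eh) * (Cgh - Ef * Eh) - (1 - Eh) * (Ef * EZ - EfZ)) + (EZ * (Ef - Efh) - (1 - Eh) * EfZ) := by ring
  nlinarith [h1, hG, key]

end Main

end CovTauStarN

end Summit.CriticalPhenomena.PercolationContinuityZ3.Theorems

end
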